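import Literature.NumberTheory.ComplexMultiplication.CMLatticeRingClassTowerCyclic
import HarnessLib

/-!
# Gross's `G_n ≃ ∏ G_ℓ` as an internal DIRECT PRODUCT: for pairwise coprime `ℓ, c, d` with `d ≥ 2`,
# `ker(I_K(ℓcd) → I_K(d)) ≅ ker(I_K(ℓcd) → I_K(cd)) × ker(I_K(ℓcd) → I_K(ℓd))`

Family `hodge`, lane `lit-hodgefound` (Track 2 foundations library; Layer A3 at `g = 1`, the «arbitrary
order» series), topic `Literature/NumberTheory/ComplexMultiplication`, namespace
`Literature.NumberTheory.ComplexMultiplication.CMTypeLattice`. The tree's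
`RingClassGroupTower.ker_restrict_eq_ker_sup_ker` proves `ker(→ d) = ker(→ cd) ⊔ ker(→ ℓd)` in
`I_K(ℓcd)/P_{K,ℤ}(ℓcd)` («`K_{cd} ∩ K_{ℓd} = K_d`»); this file upgrades the `⊔` to a DIRECT PRODUCT `≃* × ` over a
tame base level `d ≥ 2` by counting (`#ker(→ cd) · #ker(→ ℓd) = #ker(→ d)`, COR. 7.28 at the two conductors).
THEOREMS ONLY: no definition, no named fact (D-0026; net Literature debt 0).

## Sources, VERBATIM

* B. H. Gross, *Kolyvagin's work on modular elliptic curves* [GrossLMS1991], §3 (PDF p. 216 field diagram;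
  p. 217 l. 1–3): «`G_n = Gal(K_n/K_1) ≃ ∏_{ℓ ∣ n} G_ℓ`», «The subgroups `G_ℓ ≃ F_λ^×/F_ℓ^×` are cyclic of
  order `ℓ + 1`» — with `G_ℓ = Gal(K_n/K_{n/ℓ})` the internal factors.
* D. A. Cox, *Primes of the Form x² + ny²* [Cox2013], §7.D Thm. 7.24, (7.27), Cor. 7.28, pp. 146–148:
  `h(𝒪_{ℓm})/h(𝒪_m) = ℓ ∏_{p ∣ ℓ, p ∤ m}(1 − (d_K/p)/p)` for `m ≥ 2` (no unit index) — so
  `h(𝒪_{ℓcd})/h(𝒪_{cd}) = h(𝒪_{ℓd})/h(𝒪_d)` for `ℓ` prime to `c`; §9.A (Artin isomorphism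
  `I_K(f)/P_{K,ℤ}(f) ≅ Gal(K_f/K)`, under which these kernels are the Galois groups of the tower).

## What is formalised (theorems only)

`K` imaginary quadratic (`[IsCMField K]`, `finrank ℚ K = 2`); `ℓ, c ≥ 1`, `d ≥ 2` pairwise coprime,
`n = ℓcd`; `restrict : I_K(n)/P_{K,ℤ}(n) → I_K(m)/P_{K,ℤ}(m)` the change of conductor.
* §1 (private) `nonempty_mulEquiv_prod_of_sup_eq_top` (a finite commutative group generated by two subgroups
  with `#A·#B = #G` is `≃* A × B`); level transports are done inline by `subst`.
* §2 `natCard_ker_restrict_mul_coprime_eq` (**`#ker(I_K(ℓcd) → I_K(cd)) = #ker(I_K(ℓd) → I_K(d))`** for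
  `gcd(ℓ, c) = 1`, `d ≥ 2`), `natCard_ker_restrict_mul_natCard_ker_restrict`
  (`#ker(→ cd) · #ker(→ ℓd) = #ker(→ d)` in `I_K(ℓcd)/P_{K,ℤ}(ℓcd)`).
* §3 **`nonempty_mulEquiv_ker_restrict_prod`**: `ker(I_K(ℓcd) → I_K(d)) ≃* ker(I_K(ℓcd) → I_K(cd)) ×
  ker(I_K(ℓcd) → I_K(ℓd))` (Gross's `Gal(K_n/K_d) = Gal(K_n/K_{cd}) × Gal(K_n/K_{ℓd})`).

NOT here: the base `d = 1` over `Cl(𝒪_K)` (needs `𝒪_K^× = {±1}`, i.e. `d_K < −4`; the `⊔`-statement of the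
tree holds regardless), the Galois side (Layer B).

## References
* [GrossLMS1991] B. H. Gross, LMS LNS 153 (1991), §3. [cite: GrossLMS1991, §3 (PDF p. 216–217)]
* [Cox2013] D. A. Cox, *Primes of the Form x² + ny²*, 2nd ed., §7.D Thm. 7.24, Cor. 7.28, §9.A.
  [cite: Cox2013, §7.D Cor. 7.28, p. 148]

## Mathlib / tree search
Tree, BY NAME: `ker_restrict_eq_ker_sup_ker`, `span_natCast_ne_top_of_ne_one` (`RingClassGroupTower`),
`natCard_ker_restrict_mul`, `natCard_ker_restrict_eq_prod` (`…TowerDegrees`), `ker_restrict_le_ker_restrict_of_dvd`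
(`…TowerCyclic`), `restrict_surjective`, `finite_ringClassGroup`, `exists_basis_zero_eq_one`, `basis_one_mul_self_eq`.
Mathlib: `MonoidHom.coprod`, `Subgroup.mem_sup_of_normal_right`, `Subgroup.subgroupOf_sup`, `Subgroup.subgroupOf_self`,
`Nat.bijective_iff_surjective_and_card`, `MulEquiv.ofBijective`, `MulEquiv.prodCongr`, `Subgroup.subgroupOfEquivOfLe`,
`Finset.prod_congr`, `Nat.Coprime.coprime_dvd_left`, `Nat.Coprime.dvd_mul_left`.
grep «≃\* .*ker.*×|prod_of_sup» in `Literature/NumberTheory`: nothing for ring class groups.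
-/

open scoped NumberField nonZeroDivisors
open NumberField Module

namespace Literature.NumberTheory.ComplexMultiplication

open Literature.NumberTheory.QuadraticFields Literature.NumberTheory.QuadraticFields.RingClass
open Literature.NumberTheory.QuadraticFields.Quadratic
open Literature.NumberTheory.EllipticCurves (IsImaginaryQuadratic isImaginaryQuadratic_iff_isCMField)

namespace CMTypeLattice

/-! ## §1. Two subgroups generating a finite commutative group with `#A·#B = #G` (private) -/

open scoped IsMulCommutative in
/-- If `A ⊔ B = G` and `#A·#B = #G` in a finite commutative group, then `(a, b) ↦ ab` is an isomorphism
`A × B ≃* G` (onto by `A ⊔ B = AB`, hence bijective by counting). (Stated over `[Group G] [IsMulCommutative G]`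
so that it instantiates at subgroups `↥G₀` with their own `Subgroup.toGroup` instance.) [folklore] -/
private theorem nonempty_mulEquiv_prod_of_sup_eq_top {G : Type*} [Group G] [Finite G] [IsMulCommutative G]
    {A B : Subgroup G} (hsup : A ⊔ B = ⊤) (hcard : Nat.card A * Nat.card B = Nat.card G) :
    Nonempty (G ≃* A × B) := by
  set φ : A × B →* G := A.subtype.coprod B.subtype with hφ
  have hsurj : Function.Surjective φ := by
    intro x
    have hx : x ∈ A ⊔ B := hsup ▸ Subgroup.mem_top x
    obtain ⟨a, ha, c, hc, rfl⟩ := Subgroup.mem_sup_of_normal_right.1 hx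
    exact ⟨(⟨a, ha⟩, ⟨c, hc⟩), by simp [hφ]⟩
  have hbij : Function.Bijective φ :=
    (Nat.bijective_iff_surjective_and_card φ).2 ⟨hsurj, by rw [Nat.card_prod, hcard]⟩
  exact ⟨(MulEquiv.ofBijective φ hbij).symm⟩

variable {K : Type} [Field K] [NumberField K] [IsCMField K] (h2 : finrank ℚ K = 2)

/-! ## §2. `#ker(I_K(ℓcd) → I_K(cd)) = #ker(I_K(ℓd) → I_K(d))` and `#ker(→ cd)·#ker(→ ℓd) = #ker(→ d)` -/

include h2 in
/-- **`#ker(I_K(ℓm)/P_{K,ℤ}(ℓm) → I_K(m)/P_{K,ℤ}(m))` depends on `m ≥ 2` only through the primes of `ℓ` dividing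
`m`**: for `gcd(ℓ, c) = 1` and `d ≥ 2`, `#ker(I_K(ℓ·cd) → I_K(cd)) = #ker(I_K(ℓ·d) → I_K(d))`
(`= ∏_{p ∣ ℓ} p^{v_p(ℓ)−1}(p − [p ∤ d](d_K/p))`, COR. 7.28 — no unit index at levels `≥ 2`).
[cite: Cox2013, §7.D Thm. 7.24 and Cor. 7.28, pp. 146–148] [cite: GrossLMS1991, §3 (PDF p. 217 l. 1–3)] -/
theorem natCard_ker_restrict_mul_coprime_eq {ℓ c d : ℕ} (hℓ : ℓ ≠ 0) (hc : c ≠ 0) (hd : 2 ≤ d)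
    (hℓc : Nat.Coprime ℓ c) (h₁ : c * d ∣ ℓ * (c * d)) (h₂ : d ∣ ℓ * d) :
    Nat.card (restrict (K := K) h₁).ker = Nat.card (restrict (K := K) h₂).ker := by
  have hcd : 2 ≤ c * d := le_trans hd (Nat.le_mul_of_pos_left d (Nat.pos_of_ne_zero hc))
  have e₁ := natCard_ker_restrict_eq_prod h2 hℓ hcd h₁
  have e₂ := natCard_ker_restrict_eq_prod h2 hℓ hd h₂
  have key : ∀ p ∈ ℓ.primeFactors, (p ∣ c * d ↔ p ∣ d) := by
    intro p hp
    have hpc : Nat.Coprime p c := Nat.Coprime.coprime_dvd_left (Nat.dvd_of_mem_primeFactors hp) hℓc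
    exact hpc.dvd_mul_left
  have : (Nat.card (restrict (K := K) h₁).ker : ℤ) = Nat.card (restrict (K := K) h₂).ker := by
    rw [e₁, e₂]
    refine Finset.prod_congr rfl (fun p hp => ?_)
    rw [if_congr (key p hp) rfl rfl]
  exact_mod_cast this

include h2 in
/-- **`#ker(→ cd) · #ker(→ ℓd) = #ker(→ d)` in `I_K(ℓcd)/P_{K,ℤ}(ℓcd)`** for pairwise coprime `ℓ, c, d`, `d ≥ 2`
(`h(𝒪_{ℓcd})h(𝒪_d) = h(𝒪_{cd})h(𝒪_{ℓd})`, COR. 7.28). [cite: Cox2013, §7.D Cor. 7.28, p. 148]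
[cite: GrossLMS1991, §3 (PDF p. 216–217)] -/
theorem natCard_ker_restrict_mul_natCard_ker_restrict {ℓ c d : ℕ} (hℓ : ℓ ≠ 0) (hc : c ≠ 0) (hd : 2 ≤ d)
    (hℓc : Nat.Coprime ℓ c) (hdn : d ∣ ℓ * c * d) (h₁ : c * d ∣ ℓ * c * d) (h₂ : ℓ * d ∣ ℓ * c * d) :
    Nat.card (restrict (K := K) h₁).ker * Nat.card (restrict (K := K) h₂).ker =
      Nat.card (restrict (K := K) hdn).ker := by
  have hd0 : d ≠ 0 := by omega
  have hn0 : ℓ * c * d ≠ 0 := mul_ne_zero (mul_ne_zero hℓ hc) hd0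
  have hℓd0 : ℓ * d ≠ 0 := mul_ne_zero hℓ hd0
  haveI := finite_ringClassGroup (K := K) h2 hd0
  -- `#G · #RCG(d) = #RCG(n)`, `#B · #RCG(ℓd) = #RCG(n)`, `#K₂ · #RCG(d) = #RCG(ℓd)`, `#A = #K₂`
  have eG := natCard_ker_restrict_mul h2 hd0 hn0 hdn
  have eB := natCard_ker_restrict_mul h2 hℓd0 hn0 h₂
  have eK := natCard_ker_restrict_mul h2 hd0 hℓd0 (dvd_mul_left d ℓ)
  have eA : Nat.card (restrict (K := K) h₁).ker = Nat.card (restrict (K := K) (dvd_mul_left d ℓ)).ker := by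
    -- transport along the equal levels `ℓcd = ℓ·(cd)` (indices of `RingClassGroup K ·`)
    have key : ∀ {N : ℕ} (_ : N = ℓ * (c * d)) (h : c * d ∣ N),
        Nat.card (restrict (K := K) h).ker = Nat.card (restrict (K := K) (dvd_mul_left (c * d) ℓ)).ker := by
      intro N hN h; subst hN; rfl
    rw [key (by ring) h₁]
    exact natCard_ker_restrict_mul_coprime_eq h2 hℓ hc hd hℓc _ _
  have hpos : 0 < Nat.card (RingClassGroup K d) := Nat.card_pos
  -- `#B · #K₂ · #RCG(d) = #RCG(n) = #G · #RCG(d)`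
  have e : Nat.card (restrict (K := K) h₂).ker * Nat.card (restrict (K := K) (dvd_mul_left d ℓ)).ker *
      Nat.card (RingClassGroup K d) = Nat.card (restrict (K := K) hdn).ker * Nat.card (RingClassGroup K d) := by
    rw [mul_assoc, eK, eB, eG]
  rw [eA, mul_comm]
  exact Nat.eq_of_mul_eq_mul_right hpos e

/-! ## §3. The direct product decomposition -/

include h2 in
/-- **GROSS'S `G_n ≃ ∏ G_ℓ`, ONE COPRIME SPLITTING AT A TIME**: for `K` imaginary quadratic and pairwise coprime
`ℓ, c ≥ 1`, `d ≥ 2`, in `I_K(ℓcd)/P_{K,ℤ}(ℓcd)`: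
`ker(→ I_K(d)/P_{K,ℤ}(d)) ≃* ker(→ I_K(cd)/P_{K,ℤ}(cd)) × ker(→ I_K(ℓd)/P_{K,ℤ}(ℓd))` — the ideal-theoretic
`Gal(K_{ℓcd}/K_d) = Gal(K_{ℓcd}/K_{cd}) × Gal(K_{ℓcd}/K_{ℓd})` (the two subgroups generate, by the tree's
`ker_restrict_eq_ker_sup_ker` = «`K_{cd} ∩ K_{ℓd} = K_d`», and their orders multiply to the whole, §2).
[cite: GrossLMS1991, §3 (PDF p. 216 field diagram; p. 217 l. 1–3)] [cite: Cox2013, §7.D Cor. 7.28 and §9.A] -/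
theorem nonempty_mulEquiv_ker_restrict_prod {ℓ c d : ℕ} (hℓ : ℓ ≠ 0) (hc : c ≠ 0) (hd : 2 ≤ d)
    (hℓc : Nat.Coprime ℓ c) (hℓd : Nat.Coprime ℓ d) (hcd : Nat.Coprime c d)
    (hdn : d ∣ ℓ * c * d) (h₁ : c * d ∣ ℓ * c * d) (h₂ : ℓ * d ∣ ℓ * c * d) :
    Nonempty ((restrict (K := K) hdn).ker ≃* (restrict (K := K) h₁).ker × (restrict (K := K) h₂).ker) := by
  have hd0 : d ≠ 0 := by omega
  have hn0 : ℓ * c * d ≠ 0 := mul_ne_zero (mul_ne_zero hℓ hc) hd0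
  obtain ⟨b, hb⟩ := exists_basis_zero_eq_one h2
  have hω := basis_one_mul_self_eq b hb
  have hfn : Ideal.span {((ℓ * c * d : ℕ) : 𝓞 K)} ≠ ⊤ :=
    span_natCast_ne_top_of_ne_one b hb (by
      intro h1
      have : d ∣ 1 := ⟨ℓ * c, by rw [← h1]; ring⟩
      have := Nat.le_of_dvd one_pos this
      omega)
  haveI := finite_ringClassGroup (K := K) h2 hn0
  haveI : IsMulCommutative (restrict (K := K) hdn).ker :=
    ⟨⟨fun a b => Subtype.ext (by
      rw [Subgroup.coe_mul, Subgroup.coe_mul]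
      exact mul_comm (a : RingClassGroup K (ℓ * c * d)) (b : RingClassGroup K (ℓ * c * d)))⟩⟩
  -- the two subgroups inside `ker(→ d)` and the tree's `⊔` statement
  have hsup : (restrict (K := K) hdn).ker = (restrict (K := K) h₁).ker ⊔ (restrict (K := K) h₂).ker :=
    ker_restrict_eq_ker_sup_ker b hb hω rfl rfl rfl hℓc hℓd hcd hfn hdn h₁ h₂
  have hA : (restrict (K := K) h₁).ker ≤ (restrict (K := K) hdn).ker :=
    ker_restrict_le_ker_restrict_of_dvd (K := K) (dvd_mul_left d c) h₁ hdn
  have hB : (restrict (K := K) h₂).ker ≤ (restrict (K := K) hdn).ker :=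
    ker_restrict_le_ker_restrict_of_dvd (K := K) (dvd_mul_left d ℓ) h₂ hdn
  have hsup' : (restrict (K := K) h₁).ker.subgroupOf (restrict (K := K) hdn).ker ⊔
      (restrict (K := K) h₂).ker.subgroupOf (restrict (K := K) hdn).ker = ⊤ := by
    rw [← Subgroup.subgroupOf_sup hA hB, ← hsup, Subgroup.subgroupOf_self]
  have hcard : Nat.card ((restrict (K := K) h₁).ker.subgroupOf (restrict (K := K) hdn).ker) *
      Nat.card ((restrict (K := K) h₂).ker.subgroupOf (restrict (K := K) hdn).ker) =
        Nat.card (restrict (K := K) hdn).ker := by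
    rw [Nat.card_congr (Subgroup.subgroupOfEquivOfLe hA).toEquiv,
      Nat.card_congr (Subgroup.subgroupOfEquivOfLe hB).toEquiv]
    exact natCard_ker_restrict_mul_natCard_ker_restrict h2 hℓ hc hd hℓc hdn h₁ h₂
  obtain ⟨e⟩ := nonempty_mulEquiv_prod_of_sup_eq_top (G := (restrict (K := K) hdn).ker) hsup' hcard
  exact ⟨e.trans (MulEquiv.prodCongr (Subgroup.subgroupOfEquivOfLe hA) (Subgroup.subgroupOfEquivOfLe hB))⟩

end CMTypeLattice

end Literature.NumberTheory.ComplexMultiplication
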